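import Summits.QuantumFields.YangMills.Theorems.FluctuationComparisonRegPrIntLS2BetaDistributedHolonomySU2
import HarnessLib

/-!
# S2β · `hFlat` road, brick (ii-b)₃ of UV3-NODE §57.8 (D) — `SU(2)`: ARC SUBADDITIVITY, THE BOND SPLIT IN ARC CURRENCY, AND THE FINITE MINKOWSKI STEP

Cell `ym3-torus` (rung R3 = continuum `SU(2)` Yang–Mills on the three-torus — NOT d = 4, NOT infinite volume, NOT a mass gap, NOT Clay).
Width seat «width 13» `ym3-torus-px13` (gen 22), FREE px helper on crux `stmt-QuantumFields-20520`, count-neutral, DEFINITION-FREE.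

WHY (UV3-NODE §57.8 (B), px8 g21).  The recursion runs on ARCS (`arc U = ‖logVec (su2Quat U)‖ ∈ [0, π]`, the rotation half-angle = the bi-invariant geodesic
distance from `1` on `SU(2) ≅ S³`; lit ✓`T4ExpWindowSmallField.logVec`), because only in arc currency is the lift bound `‖arc I_t(X)‖₂ ≤ √L·‖arc X‖₂` an IDENTITY
(✓(ii-a) p813925).  The relative field enters through «`d_g` subadditivity + arc ≤ (π∕2)·chord ONCE» — this file:
* `cos_arccos_add_le_re_mul`, ★ `norm_logVec_su2Quat_mul_le` — `arc(X·Y) ≤ arc X + arc Y` (the spherical triangle inequality; Cauchy–Schwarz on the imaginary parts);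
* ★ `norm_logVec_le_add_pi_div_two_mul_dist1` — THE BOND SPLIT `arc (U b) ≤ arc (V b) + (π∕2)·dist1 (U b·(V b)⁻¹)` (✓`norm_logVec_le_pi_div_two_mul_dist1` applied
  to the RELATIVE field only, never recursed);
* `sqrt_sum_sq_add_le`, `sqrt_sum_sq_le_of_le_add` — finite Minkowski; ★★ `sqrt_sum_sq_norm_logVec_le` — over any finite family of bonds
  `‖arc U‖₂ ≤ ‖arc V‖₂ + (π∕2)·‖dist1 (U·V⁻¹)‖₂`: with `V` the lift (✓(ii-a)) and `U·V⁻¹` the relative field of ✓`…S2BetaRelativeFieldLetter` this IS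
  `B_t ≤ √L·B_{t+1} + R_t`.

HONEST SCOPE.  Elementary `SU(2)` ∕ real-analysis facts; nothing of Bałaban's analysis; the recursion's one-level multiplicity count and its solution (px16 g20
`…S2BetaSqrtLRecursion`) are not here; `hFlat`, TUBE-REG∘, GAP♯∘, S2β, crux 20520, `YM3TorusSU2` NOT proved; no registered stub closed; the Yang–Mills mass gap
is NOT proved.
References: T. Bałaban, CMP **99** (1985) 75–102 [Balaban1985RegularSpaces] ((1.29) p.81); CMP **96** (1984) 223–250 [Balaban1984PropagatorsII] ((1.33)).
-/

set_option autoImplicit false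

namespace Summit.QuantumFields.YangMills.Theorems.FluctuationComparisonRegPrIntLS2BetaArcBondSplit

open Finset
open Literature.MathematicalPhysics.QuantumFieldTheory.Balaban1983to89
open T4Continuum

section SU2

open scoped Real Quaternion
open Literature.MathematicalPhysics.QuantumLattice (su2Quat norm_su2Quat normSq_su2Quat)
open T4CubeChartGnomonic (SU2)
open T4ExpWindowSmallField (logVec norm_logVec)
open T4HaarSU2Translate (su2Quat_mul)
open Summit.QuantumFields.YangMills.Theorems.FluctuationComparisonRegPrIntLS2BetaDistributedHolonomySU2 (norm_logVec_le_pi_div_two_mul_dist1)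

/-- The spherical triangle inequality on `S³`, cosine form: for unit quaternions `cos(arccos re p + arccos re q) ≤ re(p·q)` (Cauchy–Schwarz on the
imaginary parts). [folklore] -/
theorem cos_arccos_add_le_re_mul (p q : ℍ) (hp : ‖p‖ = 1) (hq : ‖q‖ = 1) :
    Real.cos (Real.arccos p.re + Real.arccos q.re) ≤ (p * q).re := by
  have hp2 : p.re ^ 2 + p.imI ^ 2 + p.imJ ^ 2 + p.imK ^ 2 = 1 := by
    have h := Quaternion.normSq_eq_norm_mul_self p
    rw [hp, mul_one, Quaternion.normSq_def'] at h
    exact h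
  have hq2 : q.re ^ 2 + q.imI ^ 2 + q.imJ ^ 2 + q.imK ^ 2 = 1 := by
    have h := Quaternion.normSq_eq_norm_mul_self q
    rw [hq, mul_one, Quaternion.normSq_def'] at h
    exact h
  have hpr1 : p.re ≤ 1 := by nlinarith [sq_nonneg p.imI, sq_nonneg p.imJ, sq_nonneg p.imK]
  have hpr2 : -1 ≤ p.re := by nlinarith [sq_nonneg p.imI, sq_nonneg p.imJ, sq_nonneg p.imK, sq_nonneg (p.re + 1)]
  have hqr1 : q.re ≤ 1 := by nlinarith [sq_nonneg q.imI, sq_nonneg q.imJ, sq_nonneg q.imK]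
  have hqr2 : -1 ≤ q.re := by nlinarith [sq_nonneg q.imI, sq_nonneg q.imJ, sq_nonneg q.imK, sq_nonneg (q.re + 1)]
  rw [Real.cos_add, Real.cos_arccos hpr2 hpr1, Real.cos_arccos hqr2 hqr1, Real.sin_arccos, Real.sin_arccos, Quaternion.re_mul]
  -- Cauchy–Schwarz for the imaginary parts
  have hA : 1 - p.re ^ 2 = p.imI ^ 2 + p.imJ ^ 2 + p.imK ^ 2 := by linarith
  have hB : 1 - q.re ^ 2 = q.imI ^ 2 + q.imJ ^ 2 + q.imK ^ 2 := by linarith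
  have hcs : (p.imI * q.imI + p.imJ * q.imJ + p.imK * q.imK) ^ 2 ≤ (1 - p.re ^ 2) * (1 - q.re ^ 2) := by
    rw [hA, hB]
    nlinarith [sq_nonneg (p.imI * q.imJ - p.imJ * q.imI), sq_nonneg (p.imI * q.imK - p.imK * q.imI),
      sq_nonneg (p.imJ * q.imK - p.imK * q.imJ)]
  have hdot : p.imI * q.imI + p.imJ * q.imJ + p.imK * q.imK ≤ √(1 - p.re ^ 2) * √(1 - q.re ^ 2) := by
    rw [← Real.sqrt_mul (by rw [hA]; positivity)]
    exact (le_abs_self _).trans ((Real.sqrt_sq_eq_abs _).symm.le.trans (Real.sqrt_le_sqrt hcs))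
  linarith

/-- **SUBADDITIVITY OF THE ARC ON `SU(2)`**: `arc(X·Y) ≤ arc X + arc Y`, `arc U = ‖logVec (su2Quat U)‖ ∈ [0, π]` the rotation half-angle (the bi-invariant
geodesic distance from `1` on `SU(2) ≅ S³`). [folklore] -/
theorem norm_logVec_su2Quat_mul_le (X Y : SU2) :
    ‖logVec (su2Quat (X * Y))‖ ≤ ‖logVec (su2Quat X)‖ + ‖logVec (su2Quat Y)‖ := by
  rw [norm_logVec, norm_logVec, norm_logVec, su2Quat_mul]
  by_cases h : Real.arccos (su2Quat X).re + Real.arccos (su2Quat Y).re ≤ π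
  · calc Real.arccos (su2Quat X * su2Quat Y).re
        ≤ Real.arccos (Real.cos (Real.arccos (su2Quat X).re + Real.arccos (su2Quat Y).re)) :=
          Real.antitone_arccos (cos_arccos_add_le_re_mul _ _ (norm_su2Quat X) (norm_su2Quat Y))
      _ = _ := Real.arccos_cos (add_nonneg (Real.arccos_nonneg _) (Real.arccos_nonneg _)) h
  · exact (Real.arccos_le_pi _).trans (not_le.mp h).le

/-- ★ **THE BOND SPLIT IN ARC CURRENCY** (UV3-NODE §57.8 (B): `U′_t = I_t(U′_{t+1})·rel_t` read through `d_g` subadditivity and «arc ≤ (π∕2)·chord» ONCE, on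
the relative field): `arc (U b) ≤ arc (V b) + (π∕2)·dist1 (U b·(V b)⁻¹)` for any two `SU(2)` bond variables. [folklore] -/
theorem norm_logVec_le_add_pi_div_two_mul_dist1 (U V : SU2) :
    ‖logVec (su2Quat U)‖ ≤ ‖logVec (su2Quat V)‖ + π / 2 * dist1 (U * V⁻¹) := by
  have h := norm_logVec_su2Quat_mul_le (U * V⁻¹) V
  rw [inv_mul_cancel_right] at h
  linarith [norm_logVec_le_pi_div_two_mul_dist1 (U * V⁻¹)]

/-- **FINITE MINKOWSKI**: `√(Σ (g+h)²) ≤ √(Σ g²) + √(Σ h²)`. [folklore] -/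
theorem sqrt_sum_sq_add_le {ι : Type*} (s : Finset ι) (g h : ι → ℝ) :
    √(∑ i ∈ s, (g i + h i) ^ 2) ≤ √(∑ i ∈ s, g i ^ 2) + √(∑ i ∈ s, h i ^ 2) := by
  have hG : 0 ≤ ∑ i ∈ s, g i ^ 2 := sum_nonneg fun i _ => sq_nonneg _
  have hH : 0 ≤ ∑ i ∈ s, h i ^ 2 := sum_nonneg fun i _ => sq_nonneg _
  have hgh : ∑ i ∈ s, g i * h i ≤ √(∑ i ∈ s, g i ^ 2) * √(∑ i ∈ s, h i ^ 2) := by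
    rw [← Real.sqrt_mul hG]
    exact (le_abs_self _).trans ((Real.sqrt_sq_eq_abs _).symm.le.trans (Real.sqrt_le_sqrt (sum_mul_sq_le_sq_mul_sq s g h)))
  have hexp : ∑ i ∈ s, (g i + h i) ^ 2 = ∑ i ∈ s, g i ^ 2 + 2 * ∑ i ∈ s, g i * h i + ∑ i ∈ s, h i ^ 2 := by
    simp only [add_sq, sum_add_distrib, mul_sum, mul_assoc]
  have hkey : ∑ i ∈ s, (g i + h i) ^ 2 ≤ (√(∑ i ∈ s, g i ^ 2) + √(∑ i ∈ s, h i ^ 2)) ^ 2 := by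
    rw [hexp, add_sq, Real.sq_sqrt hG, Real.sq_sqrt hH]
    linarith
  calc √(∑ i ∈ s, (g i + h i) ^ 2) ≤ √((√(∑ i ∈ s, g i ^ 2) + √(∑ i ∈ s, h i ^ 2)) ^ 2) := Real.sqrt_le_sqrt hkey
    _ = _ := Real.sqrt_sq (add_nonneg (Real.sqrt_nonneg _) (Real.sqrt_nonneg _))

/-- Finite Minkowski under a pointwise bound: `0 ≤ f ≤ g + h` pointwise ⟹ `‖f‖₂ ≤ ‖g‖₂ + ‖h‖₂`. [folklore] -/
theorem sqrt_sum_sq_le_of_le_add {ι : Type*} (s : Finset ι) {f g h : ι → ℝ} (hf : ∀ i ∈ s, 0 ≤ f i) (hle : ∀ i ∈ s, f i ≤ g i + h i) :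
    √(∑ i ∈ s, f i ^ 2) ≤ √(∑ i ∈ s, g i ^ 2) + √(∑ i ∈ s, h i ^ 2) := by
  refine le_trans (Real.sqrt_le_sqrt (sum_le_sum fun i hi => ?_)) (sqrt_sum_sq_add_le s g h)
  exact pow_le_pow_left₀ (hf i hi) (hle i hi) 2

/-- ★★ **THE ℓ² STEP OF THE RECURSION (B) IN ARC CURRENCY**: over any finite family of bonds, `‖arc U‖₂ ≤ ‖arc V‖₂ + (π∕2)·‖dist1 (U·V⁻¹)‖₂` — with `V` the
lift of the coarser field (✓(ii-a) p813925: `‖arc V‖₂ ≤ √L·‖arc X‖₂` EXACTLY) and `U·V⁻¹` the relative field of §3–§4 this is `B_t ≤ √L·B_{t+1} + R_t`.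
[cite: Balaban1985RegularSpaces, (1.29) p.81; Balaban1984PropagatorsII, (1.33)] -/
theorem sqrt_sum_sq_norm_logVec_le {ι : Type*} (s : Finset ι) (U V : ι → SU2) :
    √(∑ i ∈ s, ‖logVec (su2Quat (U i))‖ ^ 2) ≤
      √(∑ i ∈ s, ‖logVec (su2Quat (V i))‖ ^ 2) + π / 2 * √(∑ i ∈ s, dist1 (U i * (V i)⁻¹) ^ 2) := by
  have h := sqrt_sum_sq_le_of_le_add s (f := fun i => ‖logVec (su2Quat (U i))‖) (g := fun i => ‖logVec (su2Quat (V i))‖)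
    (h := fun i => π / 2 * dist1 (U i * (V i)⁻¹)) (fun i _ => norm_nonneg _) (fun i _ => norm_logVec_le_add_pi_div_two_mul_dist1 _ _)
  have hc : √(∑ i ∈ s, (π / 2 * dist1 (U i * (V i)⁻¹)) ^ 2) = π / 2 * √(∑ i ∈ s, dist1 (U i * (V i)⁻¹) ^ 2) := by
    simp only [mul_pow, ← mul_sum]
    rw [Real.sqrt_mul (sq_nonneg _), Real.sqrt_sq (by positivity)]
  rw [hc] at h
  exact h

end SU2

end Summit.QuantumFields.YangMills.Theorems.FluctuationComparisonRegPrIntLS2BetaArcBondSplit
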